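import Mathlib
import Literature.MathematicalPhysics.QuantumLattice.XYOrder
import Literature.Probability.LatticeModels.LatticeGreenFunction
import Summits.AtomisticToContinuum.BoseEinsteinCondensation.Theses.BECStronglyRayleigh

/-!
# Ideator-2 sketch for crux `BECStronglyRayleigh.InsertionFieldDelocalisation` (stmt-AtomisticToContinuum-9673)

First lemmas of three crux idea cards (round 1, ideator 2). Everything here is stated over existing
declarations; proofs are `sorry` (crux-ideate stage: the file must ELABORATE, not prove).

* Card A `log-insertion-infrared-bound`: `functional_le_thirdMoment`, `InsertionThirdMoment`,
  `thirdMoment_implies_crux`, `green_representation`, `green_gradient_sq`, `torusGreen_zero_bounded`,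
  `morrey_torus3`.
* Card B `stirring-discrepancy-gauge`: `xyTorus_mulVec_sectorIndicator` (H·1_N = B − 3N),
  `energy_eq_contact_mean` ((E + 3N) Σψ = Σ Bψ, i.e. ε = E_π[B]).
* Card C `tower-subsolution-healing`: `xy_commutator_lowering` ([H, S⁻_tot] = −Σ_x (Σ_{y∼x} S³_y) S⁻_x),
  `subsolution_smoothing` (u ≤ e^{κt} e^{tQ} u for Q-subsolutions of a Markov generator).
-/

namespace Summit.AtomisticToContinuum.BoseEinsteinCondensation.Cruxes.InsertionFieldDelocalisation.Ideator2

open Literature.MathematicalPhysics.QuantumLattice Literature.Probability.LatticeModels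
open scoped BigOperators

noncomputable section

/-! ## Card A — third-moment reduction and the discrete Newtonian potential on the 3-torus -/

/-- The elementary inequality behind the reduction: for `r ≥ 0` on a finite index set of size `n`,
`Σr³/Σr + (Σr²)²/(Σr)² ≤ 2 n (Σr³)(Σr²)/(Σr)³` (Cauchy–Schwarz `(Σr)² ≤ n Σr²` for the first term,
Chebyshev's sum inequality `(Σr²)(Σr) ≤ n Σr³` for the second; both sides are `0` when `Σr = 0`,
matching Lean's `x/0 = 0`). -/
theorem functional_le_thirdMoment {ι : Type*} [Fintype ι] (r : ι → ℝ) (hr : ∀ i, 0 ≤ r i) :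
    (∑ i, r i ^ 3) / (∑ i, r i) + (∑ i, r i ^ 2) ^ 2 / (∑ i, r i) ^ 2 ≤
      2 * (Fintype.card ι : ℝ) * ((∑ i, r i ^ 3) * (∑ i, r i ^ 2)) / (∑ i, r i) ^ 3 := by
  sorry

/-- **AM-normalised third moment of the pair-insertion field** (ω-average of
`m₃(T) = L⁶ Σ_x (r^T_x)³ / (Σ_x r^T_x)³ = L⁻³ Σ_x (r^T_x / r̄_T)³`, `r̄_T = R_T/L³`), same binders as the crux. -/
def InsertionThirdMoment : Prop :=
  ∃ M : ℝ, ∀ (L : ℕ) [NeZero L], 2 ≤ L → ∀ N : ℕ, 2 ≤ N → 2 * N ≤ L ^ 3 →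
    ∀ ψ : TensorIndex (TorusSite 3 L) 2 → ℂ,
      ψ ∈ spinZSector 1 ((N : ℝ) - (L : ℝ) ^ 3 / 2) → ψ ≠ 0 →
      (xyTorus 3 L 1).mulVec ψ =
        ((lowestEnergyInSector 1 (xyTorus 3 L 1) ((N : ℝ) - (L : ℝ) ^ 3 / 2) : ℝ) : ℂ) • ψ →
      (∀ σ, 0 ≤ (ψ σ).re ∧ (ψ σ).im = 0) →
      let φ : Finset (TorusSite 3 L) → ℝ := fun S => (ψ (fun x => if x ∈ S then 0 else 1)).re
      let r : Finset (TorusSite 3 L) → TorusSite 3 L → ℝ := fun T x =>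
        ∑ y, (if x ∉ T ∧ y ∉ T ∧ x ≠ y then φ (insert x (insert y T)) else 0)
      ∑ T ∈ (Finset.univ : Finset (TorusSite 3 L)).powersetCard (N - 2),
          (∑ x, r T x ^ 2) * ((L : ℝ) ^ 6 * (∑ x, r T x ^ 3) / (∑ x, r T x) ^ 3) ≤
        M * ∑ T ∈ (Finset.univ : Finset (TorusSite 3 L)).powersetCard (N - 2), ∑ x, r T x ^ 2

/-- **Reduction**: the ω-averaged AM-normalised third moment bounds the crux (constant `2M`):
`L³[Σr³/R + ‖r‖⁴/R²] ≤ 2 ‖r‖² · L⁶Σr³/R³` termwise by `functional_le_thirdMoment` with `n = L³`. -/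
theorem thirdMoment_implies_crux : InsertionThirdMoment →
    Summit.AtomisticToContinuum.BoseEinsteinCondensation.Theses.BECStronglyRayleigh.InsertionFieldDelocalisation := by
  sorry

/-- **Discrete Newtonian-potential representation on the 3-torus**: every function is its mean plus the
convolution of its discrete gradient with the gradient of the (mean-zero) torus Green function;
normalisation: `torusGreen` has Fourier symbol `1/ε(p)`, `ε(p) = Σᵢ(1 − cos pᵢ)`, so `torusGreen/2` inverts
`−Δ`, `Δg(x) = Σᵢ [g(x+eᵢ) + g(x−eᵢ) − 2g(x)]`, on mean-zero functions. -/
theorem green_representation (L : ℕ) [NeZero L] (hL : 2 ≤ L) (g : TorusSite 3 L → ℝ)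
    (x : TorusSite 3 L) :
    g x - (∑ y, g y) / (L : ℝ) ^ 3 =
      (1 / 2 : ℝ) * ∑ i : Fin 3, ∑ y : TorusSite 3 L,
        (torusGreen (x - y - Pi.single i 1) - torusGreen (x - y)) *
          (g (y + Pi.single i 1) - g y) := by
  sorry

/-- **Parseval for the kernel**: the squared ℓ²-norm of the gradient of the torus Green function is
`2 · torusGreen 0 = 2 L⁻³ Σ_{k≠0} ε(p_k)⁻¹` (any `L ≥ 2`; the identity is dimension-free, its boundedness is not). -/
theorem green_gradient_sq (L : ℕ) [NeZero L] (hL : 2 ≤ L) :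
    ∑ i : Fin 3, ∑ y : TorusSite 3 L, (torusGreen y - torusGreen (y - Pi.single i 1)) ^ 2 =
      2 * torusGreen (0 : TorusSite 3 L) := by
  sorry

/-- **The d = 3 input**: the torus Green function at the origin is bounded uniformly in the side
(Watson-type constant; the tree has the even-side eventual form `torusGreen_zero_eventually_le`). -/
theorem torusGreen_zero_bounded :
    ∃ C : ℝ, ∀ (L : ℕ) [NeZero L], 2 ≤ L → torusGreen (0 : TorusSite 3 L) ≤ C := by
  sorry

/-- **Morrey-type inequality on 3-tori** (Cauchy–Schwarz on `green_representation` + `green_gradient_sq`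
+ `torusGreen_zero_bounded`): pointwise oscillation is controlled by the total Dirichlet energy with an
`L`-independent constant (false in `d = 1, 2`). -/
theorem morrey_torus3 :
    ∃ C : ℝ, ∀ (L : ℕ) [NeZero L], 2 ≤ L → ∀ (g : TorusSite 3 L → ℝ) (x : TorusSite 3 L),
      (g x - (∑ y, g y) / (L : ℝ) ^ 3) ^ 2 ≤
        C * ∑ i : Fin 3, ∑ y : TorusSite 3 L, (g (y + Pi.single i 1) - g y) ^ 2 := by
  sorry

/-! ## Card B — the XY ground state is the quasi-stationary law of stirring killed by contacts -/

/-- Number of occupied (`σ = 0`) nearest-neighbour pairs `B(σ)` on the 3-torus, as a real number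
(ordered double sum halved). -/
def contactCount (L : ℕ) [NeZero L] (σ : TensorIndex (TorusSite 3 L) 2) : ℝ :=
  (∑ x : TorusSite 3 L, ∑ y : TorusSite 3 L,
      if (torusGraph 3 L).Adj x y ∧ σ x = 0 ∧ σ y = 0 then (1 : ℝ) else 0) / 2

/-- Number of occupied sites of a configuration. -/
def occupation (L : ℕ) [NeZero L] (σ : TensorIndex (TorusSite 3 L) 2) : ℕ :=
  (Finset.univ.filter fun x => σ x = 0).card

/-- **`H · 1_N = B − 3N`** on the `N`-particle sector (`L ≥ 3`, so every site has 6 neighbours): the XY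
Hamiltonian has zero diagonal and entry `−½` exactly on the `6N − 2B(σ)` allowed hops, hence
`xyTorus 3 L 1 + 3N = −(generator of rate-½ symmetric exclusion) + B` as matrices on the sector. -/
theorem xyTorus_mulVec_sectorIndicator (L : ℕ) [NeZero L] (hL : 3 ≤ L) (N : ℕ)
    (σ : TensorIndex (TorusSite 3 L) 2) (hσ : occupation L σ = N) :
    ((xyTorus 3 L 1).mulVec (fun τ => if occupation L τ = N then (1 : ℂ) else 0)) σ =
      ((contactCount L σ - 3 * N : ℝ) : ℂ) := by
  sorry

/-- **Energy = mean contact count of the amplitude gas** (`ε := E + 3N = E_π[B]`, `π ∝ ψ`): summing the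
eigen-equation over configurations and using the symmetry of `H` and `xyTorus_mulVec_sectorIndicator`.
This is the killing-rate balance of the quasi-stationary law (and the lattice form of Lieb's 1963
amplitude relation). No positivity is needed for the identity itself. -/
theorem energy_eq_contact_mean (L : ℕ) [NeZero L] (hL : 3 ≤ L) (N : ℕ) (E : ℝ)
    (ψ : TensorIndex (TorusSite 3 L) 2 → ℂ)
    (hsupp : ∀ σ, ψ σ ≠ 0 → occupation L σ = N)
    (heig : (xyTorus 3 L 1).mulVec ψ = (E : ℂ) • ψ) :
    ((E : ℂ) + 3 * N) * ∑ σ, ψ σ = ∑ σ, ((contactCount L σ : ℝ) : ℂ) * ψ σ := by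
  sorry

/-! ## Card C — the `S⁻`-tower: contact Ward identity and one-sided parabolic smoothing -/

/-- **Contact Ward identity** for the spin-½ XY model on any finite graph:
`[H, S⁻_tot] = −Σ_x (Σ_{y ∼ x} S³_y) S⁻_x` with `H = xxzHamiltonian 1 G (−1) 0 = −Σ_{E(G)}(S¹S¹ + S²S²)`
and `S⁻_x = onSite x (spinLower 1)`. On a 6-regular graph this reads `(3 − n̂_∂x) a_x` summed over `x`. -/
theorem xy_commutator_lowering {Λ : Type} [Fintype Λ] [DecidableEq Λ] (G : SimpleGraph Λ)
    [DecidableRel G.Adj] :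
    xxzHamiltonian 1 G (-1) 0 * (∑ x : Λ, onSite x (spinLower 1)) -
        (∑ x : Λ, onSite x (spinLower 1)) * xxzHamiltonian 1 G (-1) 0 =
      -∑ x : Λ, (∑ y : Λ, if G.Adj x y then siteSpin 1 y 2 else 0) * onSite x (spinLower 1) := by
  sorry

/-- **One-sided parabolic smoothing of subsolutions** of a finite Markov generator `Q` (nonnegative
off-diagonal entries, zero row sums): if `Q u ≥ −κ u` entrywise with `κ ≥ 0` then `u ≤ e^{κt} e^{tQ} u` for
all `t ≥ 0` (Duhamel: `d/dt (e^{κt} e^{tQ} u) = e^{κt} e^{tQ}(Qu + κu) ≥ 0` by positivity of `e^{tQ}`). Applied to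
the ground-state process of the `(N−1)`-sector and `u = S⁻_tot ψ_N / ψ_{N−1}`, `κ = μ_N + 3`. -/
theorem subsolution_smoothing {ι : Type} [Fintype ι] [DecidableEq ι] (Q : Matrix ι ι ℝ)
    (hoff : ∀ i j, i ≠ j → 0 ≤ Q i j) (hrow : ∀ i, ∑ j, Q i j = 0) (κ : ℝ) (hκ : 0 ≤ κ)
    (u : ι → ℝ) (hsub : ∀ i, -κ * u i ≤ (Q.mulVec u) i) (t : ℝ) (ht : 0 ≤ t) (i : ι) :
    u i ≤ Real.exp (κ * t) * ((NormedSpace.exp (t • Q)).mulVec u) i := by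
  sorry

end

end Summit.AtomisticToContinuum.BoseEinsteinCondensation.Cruxes.InsertionFieldDelocalisation.Ideator2
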